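import Summits.Ventures.HodgeRepro2.T6N43Main
import Summits.Ventures.HodgeRepro2.T5BergmanCoefficient
import Summits.Ventures.HodgeRepro2.T5BergmanUnitary
import Summits.Ventures.HodgeRepro2.T5BergmanPairing

/-!
# T6N43BergmanModel — the (1,1)-place datum on the weight-3 Bergman model: (N4.3.P2) AND (N4.3.P2′)
by construction (Tier 6, M2; t6-p6)

Record: TIER5 v0.51 §N4.3 — R3.7 (π₀,τ′_j is the `U(W_A)_{τ′_j}`-submodule of the Fock space generated
by the Fock vector φ, with f ↔ φ), R3.11 / (N4.3.P2′) ll. 1296–1300 («an irreducible unitary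
representation of SL(2,ℝ) whose K-weights are bounded below and start at 3 is π_3^+ … the forced vector
f = 1 (the lowest K_W-type vector) is its lowest-weight vector … |⟨π₀,τ′_j(g)f, f⟩| = ‖f‖² ·
cosh(η(g)/2)^{−3}»). In kernel (this cell's Tier-5 annex, p1): the holomorphic discrete series of
weight 3 of SU(1,1) IS the weighted Bergman model of the disc — `T5BergmanCoefficient.act 3`
(`(π₃(g)f)(z) = j(g⁻¹, z)^{−3} f(g⁻¹·z)`), the pairing `⟨f₁, f₂⟩₃ = ∫_𝔻 f₁ f̄₂ (1 − |z|²) dA`, unitary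
(`T5BergmanUnitary.pairing_act_act`), a representation (`act_mul`), with the constant function `1` its
lowest-weight vector (`T5BergmanLowestWeight.weight_iff_const`: the weight-3 vectors are the constants)
and the matrix coefficient `⟨π₃(g)1, 1⟩₃ = a^{−3}·π/2` for `g = su11 a b` (`pairing_act_lowest`,
`pairing_lowest_lowest_three`), i.e. |⟨π₃(g)1, 1⟩₃| = ‖1‖₃² cosh(η/2)^{−3}.

This file extends that formula to the matrices of `U(1,1) = Z · SU(1,1)` (`act3`, the same formula on
a 2 × 2 matrix with its matrix inverse; on `SU(1,1)` it is p1's `act 3` — `act3_mat`; the centre acts by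
the scalar `z³` — `act3_smul_matrix`), computes the lowest-weight coefficient on `U(1,1)` by p1's mean-value
theorem (`pairing_act3_lowest`: `⟨π₃(M)1, 1⟩₃ = \overline{M₁₁}^{−3} · π/2`, and `|M₁₁| = cosh(η(M)/2)` for
`η(M) = 2 arsinh |M₁₀|`, `cosh_arsinh_eq_norm`), and DEFINES the local doubling datum of a (1,1)-place on
this model: `ArchDoublingDatum.ofBergman` — the coefficients are `g ↦ ⟨π₃(rep g)1, 1⟩₃` and
`g ↦ ⟨π₃(rep g)f, f⟩₃` with `f = c · 1`, the norms `‖1‖₃ = (π/2)^{1/2}` and `‖f‖₃ = |c| (π/2)^{1/2}`. On it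
BOTH interface Props of T6N43Datum.lean hold WITH NO HYPOTHESIS: `ofBergman_fockLineIdentification`
((N4.3.P2), by sesquilinearity — the same derivation as `ofFockLine_fockLineIdentification`) and
`ofBergman_lowestWeightCoefficient` ((N4.3.P2′), by the kernel computation — NO Rühl display D3, no
Bargmann interface Prop). What moves into the construction is exactly the record's identification
R3.7 + R3.11 read as a construction (the Fock submodule generated by φ, with the unitary ψ_j of
(N4.3.P2), IS the weight-3 Bergman model with φ ↦ 1): declared here as the EX content of the
datum, never asserted of an instance — the same move as `ofFockLine` (the (I-P2) discharge) and N2's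
`ofSpec`. The central character of the model on `Z ≅ U(1)` is `z ↦ z³`; the route's π₀,τ′ ⊗ χ_{V,τ′}
has the central character of its splitting datum — the two identities consumed by `N43_main_U11`
(the line identity (P2) and the MODULUS identity (P2′)) are insensitive to it (declared). The
measure `μ`, the matrix map `rep` and the L-factor `Lfac` stay the datum's own data (the displays
`Hyp.Ruhl1970_A2f` / `Hyp.EischenLiu2024_Sec2_2` are consumed on them as before). No display, no new
hypothesis. Axioms: {propext, Classical.choice, Quot.sound}. §8(d): uses an L-value-free
non-vanishing device: NO.
-/

namespace Summit.Ventures.HodgeRepro2.T6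

open MeasureTheory Complex Metric
open T5PoincareDensity T5BergmanCoefficient T5BergmanUnitary T5BergmanPairing
open scoped Real

namespace Bergman

/-- The weight-3 action on functions on the disc, for an arbitrary `2 × 2` complex matrix `M`:
`(π₃(M) f)(z) = j(M⁻¹, z)^{−3} · f(M⁻¹ · z)` with `j(N, z) = N₁₀ z + N₁₁` (p1's `denom`) and the matrix
inverse — p1's `T5BergmanCoefficient.act 3` written on the matrix (`act3_mat`). -/
noncomputable def act3 (M : Matrix (Fin 2) (Fin 2) ℂ) (f : ℂ → ℂ) (z : ℂ) : ℂ :=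
  (denom M⁻¹ z)⁻¹ ^ 3 * f (mobius M⁻¹ z)

/-- The action is linear: `π₃(M)(c f) = c · π₃(M) f`. -/
theorem act3_smul (M : Matrix (Fin 2) (Fin 2) ℂ) (c : ℂ) (f : ℂ → ℂ) :
    act3 M (fun z => c * f z) = fun z => c * act3 M f z := by
  funext z
  unfold act3
  ring

/-- `(π₃(M) 1)(z) = j(M⁻¹, z)^{−3}`. -/
theorem act3_lowest (M : Matrix (Fin 2) (Fin 2) ℂ) (z : ℂ) :
    act3 M lowest z = (denom M⁻¹ z)⁻¹ ^ 3 := by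
  simp [act3, lowest]

/-- The matrix inverse of `g ∈ SU(1,1)` is the matrix of `g⁻¹`. -/
theorem mat_inv_eq (g : T5SU11Unimodular.SU11) : (mat g)⁻¹ = mat g⁻¹ := by
  apply Matrix.inv_eq_left_inv
  show ((((g⁻¹ : T5SU11Unimodular.SU11) : Matrix.SpecialLinearGroup (Fin 2) ℂ) : Matrix (Fin 2) (Fin 2) ℂ)) *
    (((g : Matrix.SpecialLinearGroup (Fin 2) ℂ) : Matrix (Fin 2) (Fin 2) ℂ)) = 1
  rw [← Matrix.SpecialLinearGroup.coe_mul, ← Subgroup.coe_mul, inv_mul_cancel, Subgroup.coe_one,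
    Matrix.SpecialLinearGroup.coe_one]

/-- On `SU(1,1)` the matrix-level action is p1's weight-3 action: `act3 (mat g) = act 3 g`. -/
theorem act3_mat (g : T5SU11Unimodular.SU11) (f : ℂ → ℂ) : act3 (mat g) f = act 3 g f := by
  funext z
  unfold act3 act
  rw [mat_inv_eq]

/-- The centre acts by the scalar `z³`: `π₃(z • h) f = z³ · π₃(h) f` for `z ≠ 0` and invertible `h`. -/
theorem act3_smul_matrix (z : ℂ) (hz : z ≠ 0) (h : Matrix (Fin 2) (Fin 2) ℂ) (hh : IsUnit h.det)
    (f : ℂ → ℂ) : act3 (z • h) f = fun w => z ^ 3 * act3 h f w := by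
  funext w
  letI : Invertible z := invertibleOfNonzero hz
  have hinv : (z • h)⁻¹ = z⁻¹ • h⁻¹ := by rw [Matrix.inv_smul h z hh, invOf_eq_inv]
  have hden : denom (z⁻¹ • h⁻¹) w = z⁻¹ * denom h⁻¹ w := by
    simp only [denom, Matrix.smul_apply, smul_eq_mul]
    ring
  have hmob : mobius (z⁻¹ • h⁻¹) w = mobius h⁻¹ w := by
    simp only [mobius, Matrix.smul_apply, smul_eq_mul]
    rw [show z⁻¹ * h⁻¹ 0 0 * w + z⁻¹ * h⁻¹ 0 1 = z⁻¹ * (h⁻¹ 0 0 * w + h⁻¹ 0 1) by ring,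
      show z⁻¹ * h⁻¹ 1 0 * w + z⁻¹ * h⁻¹ 1 1 = z⁻¹ * (h⁻¹ 1 0 * w + h⁻¹ 1 1) by ring,
      mul_div_mul_left _ _ (inv_ne_zero hz)]
  unfold act3
  rw [hinv, hden, hmob]
  simp only [mul_inv, inv_pow, inv_inv]
  ring

/-! ### The matrices of `U(1,1)`: inverse, entries, the Cartan parameter -/

/-- `J * J = 1`. -/
theorem J_mul_J : T5UnitaryBound.J * T5UnitaryBound.J = 1 := by
  simp [T5UnitaryBound.J, Matrix.one_fin_two]

/-- The inverse of `M ∈ U(1,1)` is `J Mᴴ J`. -/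
theorem inv_eq_of_memU11 {M : Matrix (Fin 2) (Fin 2) ℂ} (hM : T5UnitaryBound.MemU11 M) :
    M⁻¹ = T5UnitaryBound.J * M.conjTranspose * T5UnitaryBound.J := by
  apply Matrix.inv_eq_left_inv
  have hM' : M.conjTranspose * T5UnitaryBound.J * M = T5UnitaryBound.J := hM
  calc T5UnitaryBound.J * M.conjTranspose * T5UnitaryBound.J * M
      = T5UnitaryBound.J * (M.conjTranspose * T5UnitaryBound.J * M) := by
        simp only [Matrix.mul_assoc]
    _ = 1 := by rw [hM', J_mul_J]

/-- The row relation `M J Mᴴ = J` of `M ∈ U(1,1)`. -/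
theorem row_relation {M : Matrix (Fin 2) (Fin 2) ℂ} (hM : T5UnitaryBound.MemU11 M) :
    M * T5UnitaryBound.J * M.conjTranspose = T5UnitaryBound.J := by
  have hM' : M.conjTranspose * T5UnitaryBound.J * M = T5UnitaryBound.J := hM
  have h1 : T5UnitaryBound.J * M.conjTranspose * T5UnitaryBound.J * M = 1 := by
    calc T5UnitaryBound.J * M.conjTranspose * T5UnitaryBound.J * M
        = T5UnitaryBound.J * (M.conjTranspose * T5UnitaryBound.J * M) := by
          simp only [Matrix.mul_assoc]
      _ = 1 := by rw [hM', J_mul_J]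
  have h2 : M * (T5UnitaryBound.J * M.conjTranspose * T5UnitaryBound.J) = 1 :=
    mul_eq_one_comm.mp h1
  calc M * T5UnitaryBound.J * M.conjTranspose
      = M * (T5UnitaryBound.J * M.conjTranspose * T5UnitaryBound.J) * T5UnitaryBound.J := by
        simp only [Matrix.mul_assoc, J_mul_J, Matrix.mul_one]
    _ = T5UnitaryBound.J := by rw [h2, Matrix.one_mul]

/-- The entries of `Mᴴ J M = J` at `(1,1)`: `|M₀₁|² − |M₁₁|² = −1`. -/
theorem normSq_col {M : Matrix (Fin 2) (Fin 2) ℂ} (hM : T5UnitaryBound.MemU11 M) :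
    ‖M 0 1‖ ^ 2 - ‖M 1 1‖ ^ 2 = -1 := by
  have hM' : M.conjTranspose * T5UnitaryBound.J * M = T5UnitaryBound.J := hM
  have h := congrFun (congrFun hM' 1) 1
  simp only [Matrix.mul_apply, Fin.sum_univ_two, Matrix.conjTranspose_apply, T5UnitaryBound.J,
    Matrix.of_apply, Matrix.cons_val', Matrix.cons_val_zero, Matrix.cons_val_one,
    Matrix.cons_val_fin_one, Fin.isValue, Complex.star_def, mul_zero, zero_add, mul_one, add_zero,
    mul_neg] at h
  have h' : ((‖M 0 1‖ : ℂ)) ^ 2 - ((‖M 1 1‖ : ℂ)) ^ 2 = -1 := by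
    rw [← Complex.conj_mul', ← Complex.conj_mul']
    linear_combination h
  exact_mod_cast h'

/-- The entries of `M J Mᴴ = J` at `(1,1)`: `|M₁₀|² − |M₁₁|² = −1`. -/
theorem normSq_row {M : Matrix (Fin 2) (Fin 2) ℂ} (hM : T5UnitaryBound.MemU11 M) :
    ‖M 1 0‖ ^ 2 - ‖M 1 1‖ ^ 2 = -1 := by
  have h := congrFun (congrFun (row_relation hM) 1) 1
  simp only [Matrix.mul_apply, Fin.sum_univ_two, Matrix.conjTranspose_apply, T5UnitaryBound.J,
    Matrix.of_apply, Matrix.cons_val', Matrix.cons_val_zero, Matrix.cons_val_one,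
    Matrix.cons_val_fin_one, Fin.isValue, Complex.star_def, mul_zero, zero_add, mul_one, add_zero,
    mul_neg] at h
  have h' : ((‖M 1 0‖ : ℂ)) ^ 2 - ((‖M 1 1‖ : ℂ)) ^ 2 = -1 := by
    rw [← Complex.mul_conj', ← Complex.mul_conj']
    linear_combination h
  exact_mod_cast h'

/-- `|M₁₁| = cosh(η/2)` for `η = 2 arsinh |M₁₀|`, `M ∈ U(1,1)`. -/
theorem cosh_arsinh_eq_norm {M : Matrix (Fin 2) (Fin 2) ℂ} (hM : T5UnitaryBound.MemU11 M) :
    Real.cosh (Real.arsinh ‖M 1 0‖) = ‖M 1 1‖ := by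
  rw [Real.cosh_arsinh]
  have h := normSq_row hM
  rw [show 1 + ‖M 1 0‖ ^ 2 = ‖M 1 1‖ ^ 2 by linarith, Real.sqrt_sq (norm_nonneg _)]

/-- `|M₁₁| > 0` and `|M₀₁| < |M₁₁|` for `M ∈ U(1,1)`. -/
theorem norm_lt_norm {M : Matrix (Fin 2) (Fin 2) ℂ} (hM : T5UnitaryBound.MemU11 M) :
    ‖M 0 1‖ < ‖M 1 1‖ := by
  have h := normSq_col hM
  nlinarith [norm_nonneg (M 0 1), norm_nonneg (M 1 1)]

/-- `j(M⁻¹, z) = −\overline{M₀₁} z + \overline{M₁₁}` for `M ∈ U(1,1)`. -/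
theorem denom_inv_eq_of_memU11 {M : Matrix (Fin 2) (Fin 2) ℂ} (hM : T5UnitaryBound.MemU11 M)
    (z : ℂ) : denom M⁻¹ z = -(starRingEnd ℂ) (M 0 1) * z + (starRingEnd ℂ) (M 1 1) := by
  rw [inv_eq_of_memU11 hM]
  simp only [denom, Matrix.mul_apply, Fin.sum_univ_two, Matrix.conjTranspose_apply, T5UnitaryBound.J,
    Matrix.of_apply, Matrix.cons_val', Matrix.cons_val_zero, Matrix.cons_val_one,
    Matrix.cons_val_fin_one, Fin.isValue, Complex.star_def, mul_zero, zero_add, mul_one, add_zero,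
    mul_neg, zero_mul, neg_zero, one_mul, neg_mul]
  ring

/-- `j(M⁻¹, z) ≠ 0` on the closed disc for `M ∈ U(1,1)`. -/
theorem denom_inv_ne_zero_of_memU11 {M : Matrix (Fin 2) (Fin 2) ℂ} (hM : T5UnitaryBound.MemU11 M)
    {z : ℂ} (hz : z ∈ closedBall (0 : ℂ) 1) : denom M⁻¹ z ≠ 0 := by
  rw [denom_inv_eq_of_memU11 hM]
  intro h
  have h' : (starRingEnd ℂ) (M 1 1) = (starRingEnd ℂ) (M 0 1) * z := by linear_combination h
  have hn : ‖M 1 1‖ ≤ ‖M 0 1‖ := by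
    have := congrArg norm h'
    rw [Complex.norm_conj, norm_mul, Complex.norm_conj] at this
    rw [this]
    exact mul_le_of_le_one_right (norm_nonneg _) (mem_closedBall_zero_iff.mp hz)
  exact absurd hn (not_le.mpr (norm_lt_norm hM))

/-- `π₃(M) 1` is holomorphic on the closed disc for `M ∈ U(1,1)`. -/
theorem differentiableOn_act3_lowest {M : Matrix (Fin 2) (Fin 2) ℂ} (hM : T5UnitaryBound.MemU11 M) :
    DifferentiableOn ℂ (act3 M lowest) (closedBall 0 1) := by
  have e : act3 M lowest = (fun z => denom M⁻¹ z)⁻¹ ^ 3 := by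
    ext z
    simp [act3_lowest]
  rw [e]
  apply DifferentiableOn.pow
  apply DifferentiableOn.inv
  · simp only [denom]
    exact ((differentiableOn_const _).mul differentiableOn_id).add (differentiableOn_const _)
  · intro z hz
    exact denom_inv_ne_zero_of_memU11 hM hz

/-- **The lowest-weight coefficient on `U(1,1)`**: `⟨π₃(M) 1, 1⟩₃ = \overline{M₁₁}^{−3} · π/2` (the
mean-value property of the holomorphic function `π₃(M) 1` against the radial weight `1 − |z|²`,
p1's `integral_ball_mul_radial_eq`). -/
theorem pairing_act3_lowest {M : Matrix (Fin 2) (Fin 2) ℂ} (hM : T5UnitaryBound.MemU11 M) :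
    pairing 3 (act3 M lowest) lowest = ((starRingEnd ℂ) (M 1 1))⁻¹ ^ 3 * ((π / 2 : ℝ) : ℂ) := by
  have hd : DiffContOnCl ℂ (act3 M lowest) (ball 0 1) :=
    DifferentiableOn.diffContOnCl
      (by rw [closure_ball (0 : ℂ) one_ne_zero]; exact differentiableOn_act3_lowest hM)
  have hw : Continuous (fun r : ℝ => (1 - r ^ 2) ^ (3 - 2)) := by fun_prop
  have key := integral_ball_mul_radial_eq (act3 M lowest) hd (fun r => (1 - r ^ 2) ^ (3 - 2)) hw
  have h0 : act3 M lowest 0 = ((starRingEnd ℂ) (M 1 1))⁻¹ ^ 3 := by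
    rw [act3_lowest, denom_inv_eq_of_memU11 hM]
    simp
  rw [← pairing_lowest_lowest_three, ← h0]
  unfold pairing
  simp only [lowest, map_one, mul_one, one_mul] at key ⊢
  exact key

/-- `|⟨π₃(M) 1, 1⟩₃| = |M₁₁|^{−3} · π/2` on `U(1,1)`. -/
theorem norm_pairing_act3_lowest {M : Matrix (Fin 2) (Fin 2) ℂ} (hM : T5UnitaryBound.MemU11 M) :
    ‖pairing 3 (act3 M lowest) lowest‖ = ‖M 1 1‖⁻¹ ^ 3 * (π / 2) := by
  rw [pairing_act3_lowest hM, norm_mul, norm_pow, norm_inv, Complex.norm_conj, Complex.norm_real,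
    Real.norm_eq_abs, abs_of_pos (by positivity : (0 : ℝ) < π / 2)]

/-- The squared norm of the forced vector `f = c · 1`: `⟨c·1, c·1⟩₃ = |c|² π/2`. -/
theorem pairing_forced (c : ℂ) :
    pairing 3 (fun z => c * lowest z) (fun z => c * lowest z) = (((‖c‖ ^ 2 * (π / 2) : ℝ)) : ℂ) := by
  rw [pairing_smul_left, pairing_smul_right, pairing_lowest_lowest_three, ← mul_assoc,
    Complex.mul_conj, Complex.normSq_eq_norm_sq]
  push_cast
  ring

end Bergman

namespace ArchDoublingDatum

open Bergman

variable {H : Type*} [MeasurableSpace H]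

/-- [definition: the EXPLICIT local doubling datum at a (1,1)-place ON THE WEIGHT-3 BERGMAN MODEL —
TIER5 R3.7 + R3.11 / (N4.3.P2′) read as a construction: the Fock submodule generated by φ, identified
with π₀,τ′ by the unitary ψ of (N4.3.P2), IS the holomorphic discrete series of weight 3 realised on the
weighted Bergman space of the disc (p1's `T5BergmanCoefficient` / `T5BergmanUnitary`), the Fock vector
φ ↦ the lowest-weight vector `1`, the forced vector `f = c · 1` on its line; the coefficients are
`g ↦ ⟨π₃(rep g) 1, 1⟩₃` and `g ↦ ⟨π₃(rep g) f, f⟩₃` (the weight-3 action `Bergman.act3` on the matrices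
of `H = U(W_A)(ℝ)_{τ′} = U(1,1)`), the norms `‖1‖₃ = (π/2)^{1/2}`, `‖f‖₃ = |c| (π/2)^{1/2}`
(`Bergman.pairing_forced`); the Haar measure `μ`, the matrix map `rep` and the L-factor `Lfac` are the
datum's own fields as in T6N43Datum.lean.] -/
noncomputable def ofBergman (μ : Measure H) (rep : H → Matrix (Fin 2) (Fin 2) ℂ)
    (rep_mem : ∀ g, T5UnitaryBound.MemU11 (rep g))
    (rep_measurable : ∀ i j, Measurable fun g => rep g i j) (c : ℂ) (hc : c ≠ 0) (Lfac : ℂ → ℂ) :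
    ArchDoublingDatum H T5UnitaryBound.MemU11 where
  μ := μ
  rep := rep
  rep_mem := rep_mem
  rep_measurable := rep_measurable
  coeffW g := pairing 3 (act3 (rep g) lowest) lowest
  coeffπ g := pairing 3 (act3 (rep g) (fun z => c * lowest z)) (fun z => c * lowest z)
  normφ := Real.sqrt (π / 2)
  normf := ‖c‖ * Real.sqrt (π / 2)
  normφ_pos := Real.sqrt_pos.mpr (by positivity)
  normf_pos := mul_pos (norm_pos_iff.mpr hc) (Real.sqrt_pos.mpr (by positivity))
  Lfac := Lfac

section ofBergman

variable (μ : Measure H) (rep : H → Matrix (Fin 2) (Fin 2) ℂ)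
  (rep_mem : ∀ g, T5UnitaryBound.MemU11 (rep g))
  (rep_measurable : ∀ i j, Measurable fun g => rep g i j) (c : ℂ) (hc : c ≠ 0) (Lfac : ℂ → ℂ)

/-- The Bergman datum's coefficient on the forced vector is `|c|²` times the one on `1`. -/
theorem ofBergman_coeffπ (g : H) :
    (ofBergman μ rep rep_mem rep_measurable c hc Lfac).coeffπ g =
      ((‖c‖ ^ 2 : ℝ) : ℂ) * (ofBergman μ rep rep_mem rep_measurable c hc Lfac).coeffW g := by
  show pairing 3 (act3 (rep g) (fun z => c * lowest z)) (fun z => c * lowest z) =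
    ((‖c‖ ^ 2 : ℝ) : ℂ) * pairing 3 (act3 (rep g) lowest) lowest
  rw [act3_smul, pairing_smul_left, pairing_smul_right, ← mul_assoc, Complex.mul_conj,
    Complex.normSq_eq_norm_sq]

/-- (N4.3.P2) holds BY CONSTRUCTION on the Bergman datum (sesquilinearity of the pairing, as in
`ofFockLine_fockLineIdentification`): no hypothesis. -/
theorem ofBergman_fockLineIdentification :
    (ofBergman μ rep rep_mem rep_measurable c hc Lfac).FockLineIdentification := by
  intro g
  rw [ofBergman_coeffπ]
  show pairing 3 (act3 (rep g) lowest) lowest =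
    ((Real.sqrt (π / 2) ^ 2 / (‖c‖ * Real.sqrt (π / 2)) ^ 2 : ℝ) : ℂ) *
      (((‖c‖ ^ 2 : ℝ) : ℂ) * pairing 3 (act3 (rep g) lowest) lowest)
  have hc0 : ‖c‖ ≠ 0 := norm_ne_zero_iff.mpr hc
  have hs : Real.sqrt (π / 2) ^ 2 = π / 2 := Real.sq_sqrt (by positivity)
  rw [← mul_assoc, ← Complex.ofReal_mul, mul_pow, hs,
    show π / 2 / (‖c‖ ^ 2 * (π / 2)) * ‖c‖ ^ 2 = 1 by field_simp, Complex.ofReal_one, one_mul]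

/-- (N4.3.P2′) holds BY CONSTRUCTION on the Bergman datum — the kernel computation of the
lowest-weight coefficient (`Bergman.norm_pairing_act3_lowest`, `Bergman.cosh_arsinh_eq_norm`): no Rühl
display, no Bargmann interface Prop, no hypothesis. -/
theorem ofBergman_lowestWeightCoefficient :
    (ofBergman μ rep rep_mem rep_measurable c hc Lfac).LowestWeightCoefficient := by
  intro g
  rw [ofBergman_coeffπ]
  show ‖((‖c‖ ^ 2 : ℝ) : ℂ) * pairing 3 (act3 (rep g) lowest) lowest‖ =
    (‖c‖ * Real.sqrt (π / 2)) ^ 2 *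
      Real.cosh ((2 * Real.arsinh ‖rep g 1 0‖) / 2) ^ (-3 : ℤ)
  rw [norm_mul, norm_pairing_act3_lowest (rep_mem g), Complex.norm_real, Real.norm_eq_abs,
    abs_of_nonneg (by positivity), show 2 * Real.arsinh ‖rep g 1 0‖ / 2 = Real.arsinh ‖rep g 1 0‖ by ring,
    cosh_arsinh_eq_norm (rep_mem g), mul_pow, Real.sq_sqrt (by positivity : (0 : ℝ) ≤ π / 2),
    zpow_neg, zpow_ofNat, inv_pow]
  ring

/-- The Bergman datum's `eta` is the Cartan parameter of `rep`. -/
theorem ofBergman_eta (g : H) :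
    (ofBergman μ rep rep_mem rep_measurable c hc Lfac).eta g = 2 * Real.arsinh ‖rep g 1 0‖ :=
  rfl

/-- The Bergman datum's measure, matrix map and L-factor are the given ones. -/
theorem ofBergman_μ : (ofBergman μ rep rep_mem rep_measurable c hc Lfac).μ = μ := rfl

/-- `rep`. -/
theorem ofBergman_rep : (ofBergman μ rep rep_mem rep_measurable c hc Lfac).rep = rep := rfl

/-- `Lfac`. -/
theorem ofBergman_Lfac : (ofBergman μ rep rep_mem rep_measurable c hc Lfac).Lfac = Lfac := rfl

end ofBergman

end ArchDoublingDatum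

end Summit.Ventures.HodgeRepro2.T6
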